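import Literature.MathematicalPhysics.QuantumLattice.TorusSectorGibbsEntropyRowPressureNumber
import Literature.MathematicalPhysics.QuantumLattice.TorusSectorPressureTypeBoundAllTori
import HarnessLib

/-!
# Certificates along ONE divergent side sequence bound THE thermal pressure; the type-class and open-box
# floors as rows on the number `pressureTT'`

Topic `MathematicalPhysics/QuantumLattice` (family `hubbard`); sequel of `HubbardTTPrimeThermalPressureLimit.lean`.
Before the existence theorem `tendsto_sectorPressureTT'`, a pressure certificate valid only along SPECIAL tori (box-
compatible side lengths `L = K a`, the `hbox` hypotheses of `TorusSectorGibbsOpenBoxBound` / `TorusSectorPressureTypeBound`)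
bounded only the torus limits taken along those tori. Since the limit exists, a floor or a ceiling certified along
ANY ONE side sequence `Ls → ∞` is a bound on the number `p = pressureTT' β t t' U n` and hence (dictionary of
`HubbardTTPrimeThermalPressure{,Limit}`) on EVERY torus limit:

(the subsequence dictionary itself is `TorusSectorGibbsEntropyRowPressureNumber.lean`, hubbard-thermal p1). This file adds
the type-class floor — certificate C2 of the thermal family, `TorusSectorPressureTypeBoundAllTori` §4 — as a row on the number:

* `typeFreeEntropy_div_le_pressureTT'` — `(q log q − Σ_s m_s log m_s + Σ_s m_s log z_s)/(q a b) ≤ p(β; t,t',U; n)` from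
  certified open-box sector floors `0 < z_s ≤ Re Z_β(H^open_{a×b}; s)` and a balanced base type `m` of density `n`;
* `halfRectN_mul_of_commensurate` — along the box-built tori `L = K a` of a commensurate filling `n a² = 2a₀` the sectors
  of record are `K² a₀` (the `hbox` bookkeeping, for users of the one-box rows).

Everything is PROVED; no definition, no named fact.

## Mathlib / tree search

REUSED: `le_pressureTT'_of_eventually_subseq` (`TorusSectorGibbsEntropyRowPressureNumber`),
`InfVolFermionState.eventually_typeFreeEntropy_mul_sq_le_log_partitionFn_allTori` (`TorusSectorPressureTypeBoundAllTori`).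
`lean search 'typeFreeEntropy.*pressureTT'`: nothing (2026-08-27).

## References

* R. B. Israel, *Convexity in the Theory of Lattice Gases* (1979), Thm. I.2.4, Lemma II.3.1. [cite: Israel1979, Thm. I.2.4]
* D. Ruelle, *Statistical Mechanics: Rigorous Results* (1969), §3.3 (sub-box trial states). [cite: Ruelle1969, §3.3]
-/

noncomputable section

namespace Literature.MathematicalPhysics.QuantumLattice

open Matrix Finset HubbardWave0 Literature.Probability.LatticeModels
open _root_.Filter
open scoped _root_.Topology ComplexOrder BigOperators

namespace ThermodynamicLimit


/-! ### The type-class floor (certificate C2) as a row on the number -/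

/-- **The type-class floor is a row on the pressure**: in the setting of
`InfVolFermionState.eventually_typeFreeEntropy_mul_sq_le_log_partitionFn_allTori` (open `a × b` boxes, box sectors `S`
with certified floors `0 < z_s ≤ Re Z_β(H^open_{a×b}; s)`, a balanced base type `m` of size `q ≥ 1` with type density
`n = 2A₀/(qab)`, `0 ≤ n < 2`, `β ≥ 0`, `U ≥ 0`):
`(q log q − Σ_s m_s log m_s + Σ_s m_s log z_s)/(q a b) ≤ p(β; t,t',U; n)`. [cite: Ruelle1969, §3.3]
[cite: Israel1979, Lemma II.3.1] -/
theorem typeFreeEntropy_div_le_pressureTT' (t t' : ℝ) {U : ℝ} (hU : 0 ≤ U) {n : ℝ} (hn0 : 0 ≤ n) (hn2 : n < 2)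
    {β : ℝ} (hβ : 0 ≤ β) {a b : ℕ} (ha : 1 ≤ a) (hb : 1 ≤ b) (S : Finset (ℕ × ℕ)) (m : ℕ × ℕ → ℕ) {q A₀ : ℕ}
    (hq : 1 ≤ q) (hmS : ∀ s, m s ≠ 0 → s ∈ S) (hsum : ∑ s ∈ S, m s = q) (hA : ∑ s ∈ S, m s * s.1 = A₀)
    (hB : ∑ s ∈ S, m s * s.2 = A₀) (hn : n * ((q : ℝ) * a * b) = 2 * A₀)
    {z : ℕ × ℕ → ℝ} (hz0 : ∀ s ∈ S, 0 < z s)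
    (hz : ∀ s ∈ S, z s ≤ (partitionFn β (spinSectorHamiltonian s.1 s.2 (hubbardOpenBoxTT' a b t t' U))).re) :
    ((q : ℝ) * Real.log q - ∑ s ∈ S, (m s : ℝ) * Real.log (m s) + ∑ s ∈ S, (m s : ℝ) * Real.log (z s)) /
        ((q : ℝ) * a * b) ≤ pressureTT' β t t' U n :=
  le_pressureTT'_of_eventually_subseq hβ t t' hU hn0 hn2 tendsto_id fun _ hε =>
    InfVolFermionState.eventually_typeFreeEntropy_mul_sq_le_log_partitionFn_allTori t t' U n hβ ha hb S m hq hmS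
      hsum hA hB hn hn2.le hz0 hz tendsto_id hε

/-! ### Box-built tori of a commensurate filling -/

/-- Along the box-built tori `L_j = (j+2)·a` of a commensurate filling `n a² = 2a₀`, the sectors of record are
`k_{L_j} = (j+2)² a₀`. [cite: Ruelle1969, §3.3] -/
theorem halfRectN_mul_of_commensurate {n : ℝ} {a a₀ : ℕ} (hna : n * (a : ℝ) ^ 2 = 2 * a₀) (K : ℕ) :
    halfRectN n (K * a) = K * K * a₀ := by
  unfold halfRectN
  have h : n * (((K * a : ℕ) : ℝ)) ^ 2 / 2 = ((K * K * a₀ : ℕ) : ℝ) := by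
    push_cast
    have : n * ((K : ℝ) * a) ^ 2 / 2 = (K : ℝ) * K * (n * (a : ℝ) ^ 2 / 2) := by ring
    rw [this, hna]
    ring
  rw [h, Nat.floor_natCast]

end ThermodynamicLimit

end Literature.MathematicalPhysics.QuantumLattice
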